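import Summits.QuantumFields.BalabanUV.T4Continuum.Support.OutputRateResidual

/-!
# OutputRateInsertion — wall W4 (`StepModel.InsertionRate`: the two runs' HISTORY-INSERTION maps) of binder row NE5 (node U3)
# PRODUCED by the route's own technique — one unit-disc Cauchy estimate in the insertion OPERATORS — from a W1-type operator
# rate ∧ a W2-type insertion envelope ∧ reach; under the same-data reading, from W1 itself (cell `pub-balaban`, T⁴ fan-out,
# `HOME/BINDER-OWNERS.md` row NE5, owner lineage t4-ne5-p1, gen 25; LEAN PLACEMENT RULE 2026-08-19: cell bookkeeping under
# `Summits/`, published statements only under `Literature/`)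

HONEST FRAMING (T4-DAG PAGE 1).  The cell's T⁴ target is rung (B)+1: existence AND uniqueness of the ε → 0 limit of Bałaban's
unit-scale averaged gauge-invariant expectations on a FIXED finite torus T⁴ — NOT infinite volume, NOT a mass gap, NOT the Clay
problem; the spine's conditionals (`FlowStep.BetaPertH`, (B), (B^μ)) are untouched and NOT hidden here.  The spine estimate NE5
(shape `T4OutputRate.NE5`) is NOT PRINTED in [Balaban1987RG1]–[Balaban1989LargeFieldII] (ε-UNIFORM BOUNDS are printed, never
two-spacing RATES; cell GAPS G-t4-U3-1) and is NOT PROVED here or anywhere in the tree: Bałaban's functionals are not constructed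
in the tree, every `StepModel` / `InsOpModel` below is ABSTRACT DATA and every wall a HYPOTHESIS SHAPE consumed BY NAME.  Nothing
printed is asserted; no print quotation is introduced (0 cite tags; the located print of the insertion mechanism — [II] p. 3 (the
s-dependent propagators H(s), G̃(s), H₀(s)), p. 5 (analyticity and bounds of H(s(Y₀)) on |s| ≤ e^{κ₁}), p. 7 (t_□-differentiation
and the Cauchy formula), Lemma 1 (1.33)–(1.36) p. 9 — is quoted verbatim in the imported Literature leaf `T4InputCauchyRateData`
§11 and in the lineage record `t4/T4-EST-NE5-P1.md` §1).  Spine estimates PROVED: 0/9, unchanged.  HONEST DEPENDENCY (cell,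
verbatim): continuum YM on T⁴ ⇐ BetaPertH ∧ nine spine estimates (0/9 proved); BetaPertH ⇐ (D1) ∧ (D4) ∧ CAP+tail; G-an2-4
gates asym, D1 and NE2/3/4.

WHAT THIS MODULE IS.  Route P1 (`T4InputCauchyRate{,Data,Species,Termwise,Secant,Sharp}`, residual `OutputRateResidual`)
reduces NE5 to the typed walls W1 (`StepModel.OperatorRate δ θ`: the two runs' step-k OPERATOR data differ by `≤ δθ^k` margins —
node U1a/U1b's NE2/NE3 currency), W2 (`DataLipschitz`), W3, W4 (`StepModel.InsertionRate κ E₀ δ′ θ`: at a fixed table of level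
`E₀` the two runs' step-k insertion maps differ by `≤ δ′θ^k` history margins), MI-R, S, R.  Up to gen 24, W4 was the one wall of
the route with NO producer theorem (walls sheet `WALLS-NE5-P1.md` v13 row W4 "operator type (like W1) … U1a/U3 jointly"; every
model of the lineage has `δ′ = 0`).  The printed mechanism behind the insertion is the step's own: earlier actions are
re-expressed through the step's OPERATORS, analytically and with bounds along complex one-parameter deformations of them.  So at
a FIXED TABLE the insertion is ONE functional `Ins_k(o, t)` of an insertion-operator datum `o` for both runs (the spacing sits in
the DATA, as for `Out` in `RepresentsA`/`RepresentsB`), and: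
* §1 DATA `InsOpModel M OpI` + SHAPES `ReadsIns` (MI-R-ins), `InsOpRate δI θ` (W1-ins, margin units), `InsOpEnvelope κ E₀ Gi`
  (W2-ins: along every complex operator line `opIB + ζu`, `|ζ| ≤ 1`, `‖u‖ ≤ rI`, the insertion of a level-`E₀` table is complex
  differentiable on the closed unit disc and bounded by `Gi` history margins), `InsBoundA κ E₀ Gi` (run A's one-run size bound).
* §2 `norm_ins_sub_le_of_reach` (pointwise Cauchy step, `T4InputCauchyRateData.norm_sub_le_of_unitDisc_near` BY NAME),
  `insertionRate_of_insOp_near` (reach at every scale ⟹ `InsertionRate κ E₀ (Gi·δI/(1 − ρ₀)) θ`), `insertionRate_of_insOp`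
  (reach from `k₀` on, first scales by the one-run bounds ⟹ `InsertionRate κ E₀ (Gi·δI/(1 − ρ₀) + 2Gi/θ^{k₀}) θ`).
* §3 SAME-DATA READING `InsOpModel.ofStep M Ins` (the insertion operators ARE the step's operator data, margin `rOp`):
  `InsOpRate ≡ OperatorRate` (`Iff.rfl`) and W4 follows from W1 (`insertionRate_of_operatorRate{_near,}`).
* §4 THE RESIDUAL WITH W4 PRODUCED: `ne5_at_of_entrywise_lip_insOp_nat` (generic species) and
  `ne5_at_of_entrywise_lip_readsIns_nat` (same data: the W4 binder `hins` of `OutputRateResidual.ne5_at_of_entrywise_lip_nat`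
  replaced by `ReadsIns ∧ InsOpEnvelope ∧ InsBoundA ∧ reach` and NOTHING ELSE — the rate is W1's own entrywise binder).
* NON-VACUITY WITH `δ′ > 0` (the lineage's first η-DEPENDENT insertion) is the sibling module `OutputRateInsertionWitness`
  (`insToyModel`: the Cauchy route gives `InsertionRate 0 3 (9/128) (1/2)`, the direct computation `3/256` — loss factor
  exactly 6, CONSTANT-only: δ′ enters NE5's constant `Λ(δ + δ′) + B`, never the exponent or S).

STATUS OF THE RE-TYPED WALL (census).  NOT PRINTED, unchanged in currency: `InsOpEnvelope` is — like `OpFibreEnvelope`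
(G-ne5p1-1″) — a printed one-run proof re-read with a SUBSTITUTED operator deformation (under the cell's ABSOLUTE RULE not a cited
fact); `InsOpRate` is node U1a/U1b's NE2/NE3-type statement for the insertion operators, NOT PRINTED; `ReadsIns` is MI-R-kind
bookkeeping.  EFFECT ON THE ROW: route P1's walls become {W1 (W1-ins ≡ W1 under §3), W2-op, W2-hist, W2-ins, W3, MI-R + ReadsIns,
S, R + insertion reach}: one fewer INDEPENDENT η-rate input (W4 produced, not posited); no wall discharged from print; S and the
exponent untouched.  NE5 NOT PRINTED / NOT PROVED; spine 0/9; rung (B)+1 finite T⁴ only; NOT infinite volume / mass gap / Clay.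
-/

noncomputable section

open Set Finset Metric

namespace Summit.QuantumFields.BalabanUV.T4Continuum.OutputRateInsertion

open Literature.MathematicalPhysics.QuantumFieldTheory.Balaban1983to89
open Literature.MathematicalPhysics.QuantumFieldTheory.Balaban1983to89.T4OutputRate
open Literature.MathematicalPhysics.QuantumFieldTheory.Balaban1983to89.T4InputCauchyRate
open Literature.MathematicalPhysics.QuantumFieldTheory.Balaban1983to89.T4InputCauchyRateData
open Literature.MathematicalPhysics.QuantumFieldTheory.Balaban1983to89.T4OperatorRateLiaison
open Summit.QuantumFields.BalabanUV.T4Continuum.OutputRateResidual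

/-! ## §1 The insertion-operator species and its hypothesis shapes -/

section Species

variable {C : Carriers} {Op Hist : Type*} [NormedAddCommGroup Op] [NormedSpace ℂ Op] [NormedAddCommGroup Hist]
  [NormedSpace ℂ Hist]

/-- HYPOTHESIS-CARRYING DATA (no inequality inside): an INSERTION-OPERATOR SPECIES for the step model `M`.  `Ins k o t` = the
step-`k` insertion of the table `t` of earlier outputs computed from an insertion-operator datum `o : OpI` (ONE functional for
both runs); `opIA`/`opIB` = the two runs' insertion-operator data (run A at the transported background); `rI k` = the
analyticity margin of `Ins k · t` in `o`.  Abstract: nothing of [II] (1.22)–(1.24)/(1.33) is modelled. [folklore] -/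
structure InsOpModel (M : StepModel C Op Hist) (OpI : Type*) [NormedAddCommGroup OpI] [NormedSpace ℂ OpI] where
  /-- the one insertion functional at step `k`: insertion-operator datum ↦ table ↦ inserted history -/
  Ins : ℕ → OpI → (C.Dom → ℝ) → Hist
  /-- run A's insertion-operator data at step `k` -/
  opIA : (ℕ → ℝ) → C.BgB → ℕ → OpI
  /-- run B's insertion-operator data at step `k` -/
  opIB : (ℕ → ℝ) → C.BgB → ℕ → OpI
  /-- insertion-operator margin at step `k` -/
  rI : ℕ → ℝ
  rI_pos : ∀ k, 0 < rI k

namespace InsOpModel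

variable {M : StepModel C Op Hist} {OpI : Type*} [NormedAddCommGroup OpI] [NormedSpace ℂ OpI] (N : InsOpModel M OpI)

/-- HYPOTHESIS SHAPE `ReadsIns` (MI-R-ins, representation bookkeeping): BOTH runs' insertion maps of the step model are the one
functional `Ins k` read at the run's own insertion-operator datum. [folklore] -/
def ReadsIns (W : Set (ℕ → ℝ)) : Prop :=
  ∀ k, ∀ g ∈ W, ∀ (U : C.BgB) (t : C.Dom → ℝ),
    M.insA g U k t = N.Ins k (N.opIA g U k) t ∧ M.insB g U k t = N.Ins k (N.opIB g U k) t

/-- HYPOTHESIS SHAPE `InsOpRate δI θ` (W1-ins; NOT PRINTED — node U1a/U1b's NE2/NE3-type two-spacing rate for the INSERTION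
operators, MARGIN units): the two runs' insertion-operator data at step `k` differ by at most `δI·θ^k` margins. [folklore] -/
def InsOpRate (W : Set (ℕ → ℝ)) (δI θ : ℝ) : Prop :=
  ∀ k, ∀ g ∈ W, ∀ (U : C.BgB), ‖N.opIA g U k - N.opIB g U k‖ ≤ δI * θ ^ k * N.rI k

/-- HYPOTHESIS SHAPE `InsOpEnvelope κ E₀ Gi` (W2-ins; NOT PRINTED as a parametrised statement — the printed one-run s/t_□
analyticity with the bound (1.36), re-read along a substituted margin-bounded affine OPERATOR deformation): at run B's
insertion-operator datum, for every level-`E₀` table and every direction `u` within the margin, `ζ ↦ Ins k (opIB + ζ•u) t` is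
complex differentiable on the closed unit disc and bounded by `Gi` history margins there. [folklore] -/
def InsOpEnvelope (W : Set (ℕ → ℝ)) (κ E₀ Gi : ℝ) : Prop :=
  ∀ k, ∀ g ∈ W, ∀ (U : C.BgB) (t : C.Dom → ℝ), (∀ Y, |t Y| ≤ E₀ * Real.exp (-(κ * C.d Y))) →
    ∀ u : OpI, ‖u‖ ≤ N.rI k →
      DifferentiableOn ℂ (fun ζ : ℂ => N.Ins k (N.opIB g U k + ζ • u) t) (closedBall 0 1) ∧
        ∀ ζ ∈ closedBall (0 : ℂ) 1, ‖N.Ins k (N.opIB g U k + ζ • u) t‖ ≤ Gi * M.rHist k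

/-- HYPOTHESIS SHAPE `InsBoundA κ E₀ Gi` (one-run SIZE bound of the printed KIND, substituted input table): run A's insertion
of any level-`E₀` table is bounded by `Gi` history margins.  Used only below the reach scale. [folklore] -/
def InsBoundA (W : Set (ℕ → ℝ)) (κ E₀ Gi : ℝ) : Prop :=
  ∀ k, ∀ g ∈ W, ∀ (U : C.BgB) (t : C.Dom → ℝ), (∀ Y, |t Y| ≤ E₀ * Real.exp (-(κ * C.d Y))) →
    ‖N.Ins k (N.opIA g U k) t‖ ≤ Gi * M.rHist k

/-- Under the envelope, run B's own insertion (the line at `ζ = 0`) obeys the one-run bound `Gi·rHist`. [folklore] -/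
theorem norm_insB_le_of_envelope {W : Set (ℕ → ℝ)} {κ E₀ Gi : ℝ} (henv : N.InsOpEnvelope W κ E₀ Gi) {k : ℕ}
    {g : ℕ → ℝ} (hg : g ∈ W) (U : C.BgB) {t : C.Dom → ℝ} (ht : ∀ Y, |t Y| ≤ E₀ * Real.exp (-(κ * C.d Y))) :
    ‖N.Ins k (N.opIB g U k) t‖ ≤ Gi * M.rHist k := by
  obtain ⟨_, hbd⟩ := henv k g hg U t ht 0 (by rw [norm_zero]; exact (N.rI_pos k).le)
  simpa using hbd 0 (mem_closedBall_self zero_le_one)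

end InsOpModel

end Species

/-! ## §2 W4 from W1-ins ∧ W2-ins ∧ reach: one unit-disc Cauchy estimate in the insertion operators -/

section Cauchy

variable {C : Carriers} {Op Hist : Type*} [NormedAddCommGroup Op] [NormedSpace ℂ Op] [NormedAddCommGroup Hist]
  [NormedSpace ℂ Hist] [CompleteSpace Hist]

namespace InsOpModel

variable {M : StepModel C Op Hist} {OpI : Type*} [NormedAddCommGroup OpI] [NormedSpace ℂ OpI] (N : InsOpModel M OpI)

/-- **POINTWISE CAUCHY STEP IN THE INSERTION OPERATORS.**  If run A's insertion-operator datum is within RELATIVE reach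
`ρ₀ < 1` of run B's (`‖o_A − o_B‖ ≤ ρ₀·rI`), the two insertions of one level-`E₀` table differ by at most
`(Gi/(1 − ρ₀))·(‖o_A − o_B‖/rI)·rHist` — `norm_sub_le_of_unitDisc_near` along `o_B + ζu`, `u = (o_A − o_B)/a`,
`a = ‖o_A − o_B‖/rI`, at `ζ = a`. [folklore] -/
theorem norm_ins_sub_le_of_reach {W : Set (ℕ → ℝ)} {κ E₀ Gi ρ₀ : ℝ} (henv : N.InsOpEnvelope W κ E₀ Gi) (hρ₀ : ρ₀ < 1)
    {k : ℕ} {g : ℕ → ℝ} (hg : g ∈ W) (U : C.BgB) {t : C.Dom → ℝ} (ht : ∀ Y, |t Y| ≤ E₀ * Real.exp (-(κ * C.d Y)))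
    (hreach : ‖N.opIA g U k - N.opIB g U k‖ ≤ ρ₀ * N.rI k) :
    ‖N.Ins k (N.opIA g U k) t - N.Ins k (N.opIB g U k) t‖ ≤
      Gi / (1 - ρ₀) * (‖N.opIA g U k - N.opIB g U k‖ / N.rI k) * M.rHist k := by
  have hrI := N.rI_pos k
  set a := ‖N.opIA g U k - N.opIB g U k‖ / N.rI k with ha_def
  have ha0 : 0 ≤ a := by positivity
  have hqa : ‖N.opIA g U k - N.opIB g U k‖ = a * N.rI k := by rw [ha_def, div_mul_cancel₀ _ hrI.ne']
  have haρ : a ≤ ρ₀ := le_of_mul_le_mul_right (by rw [← hqa]; exact hreach) hrI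
  rcases ha0.eq_or_lt with hzero | hpos
  · have h0 : ‖N.opIA g U k - N.opIB g U k‖ = 0 := by rw [hqa, ← hzero, zero_mul]
    rw [norm_eq_zero, sub_eq_zero] at h0
    rw [h0, sub_self, norm_zero, ← hzero, mul_zero, zero_mul]
  · have hne : (a : ℂ) ≠ 0 := Complex.ofReal_ne_zero.mpr hpos.ne'
    set u : OpI := (a : ℂ)⁻¹ • (N.opIA g U k - N.opIB g U k) with hu_def
    have hu : ‖u‖ ≤ N.rI k := by
      rw [hu_def, norm_smul, norm_inv, Complex.norm_real, Real.norm_eq_abs, abs_of_pos hpos, hqa,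
        inv_mul_cancel_left₀ hpos.ne']
    obtain ⟨hdiff, hbd⟩ := henv k g hg U t ht u hu
    have hend : N.opIB g U k + (a : ℂ) • u = N.opIA g U k := by
      rw [hu_def, smul_smul, mul_inv_cancel₀ hne, one_smul, add_sub_cancel]
    have key := norm_sub_le_of_unitDisc_near hdiff hbd ha0 hρ₀ haρ
    beta_reduce at key
    rw [hend, zero_smul, add_zero] at key
    calc ‖N.Ins k (N.opIA g U k) t - N.Ins k (N.opIB g U k) t‖ ≤ Gi * M.rHist k / (1 - ρ₀) * a := key
      _ = Gi / (1 - ρ₀) * a * M.rHist k := by ring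

/-- **W4 FROM W1-ins ∧ W2-ins, REACH AT EVERY SCALE.**  `ReadsIns` ∧ `InsOpEnvelope κ E₀ Gi` ∧ `InsOpRate δI θ` with
`δI·θ^k ≤ ρ₀ < 1` for every `k` (e.g. `δI ≤ ρ₀`, `0 ≤ θ ≤ 1`) ⟹ `StepModel.InsertionRate κ E₀ (Gi·δI/(1 − ρ₀)) θ`.  No other
smallness; `1/(1 − ρ₀)` is the Cauchy conversion sup → Lipschitz, as for W2 (`dataLipschitz_of_fibreEnvelopes`). [folklore] -/
theorem insertionRate_of_insOp_near {W : Set (ℕ → ℝ)} {κ E₀ Gi δI θ ρ₀ : ℝ} (hread : N.ReadsIns W)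
    (henv : N.InsOpEnvelope W κ E₀ Gi) (hrate : N.InsOpRate W δI θ) (hρ₀ : ρ₀ < 1)
    (hreach : ∀ k, δI * θ ^ k ≤ ρ₀) : M.InsertionRate W κ E₀ (Gi * δI / (1 - ρ₀)) θ := by
  intro k g hg U t ht
  obtain ⟨hA, hB⟩ := hread k g hg U t
  have hrI := N.rI_pos k
  have hGi : 0 ≤ Gi := (mul_nonneg_iff_of_pos_right (M.rHist_pos k)).mp
    ((norm_nonneg _).trans (N.norm_insB_le_of_envelope henv hg U ht))
  have hdisp : ‖N.opIA g U k - N.opIB g U k‖ ≤ ρ₀ * N.rI k :=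
    (hrate k g hg U).trans (mul_le_mul_of_nonneg_right (hreach k) hrI.le)
  have hrel : ‖N.opIA g U k - N.opIB g U k‖ / N.rI k ≤ δI * θ ^ k := by
    rw [div_le_iff₀ hrI]; exact hrate k g hg U
  have h1ρ₀ : 0 < 1 - ρ₀ := by linarith
  rw [hA, hB]
  calc ‖N.Ins k (N.opIA g U k) t - N.Ins k (N.opIB g U k) t‖
      ≤ Gi / (1 - ρ₀) * (‖N.opIA g U k - N.opIB g U k‖ / N.rI k) * M.rHist k :=
        N.norm_ins_sub_le_of_reach henv hρ₀ hg U ht hdisp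
    _ ≤ Gi / (1 - ρ₀) * (δI * θ ^ k) * M.rHist k :=
        mul_le_mul_of_nonneg_right (mul_le_mul_of_nonneg_left hrel (div_nonneg hGi h1ρ₀.le)) (M.rHist_pos k).le
    _ = Gi * δI / (1 - ρ₀) * θ ^ k * M.rHist k := by ring

/-- **W4 FROM W1-ins ∧ W2-ins, REACH FROM A SCALE `k₀` ON.**  With `0 < θ ≤ 1`, `δI·θ^{k₀} ≤ ρ₀ < 1` and run A's one-run
bound `InsBoundA`: from `k₀` on the Cauchy step applies; below `k₀` the two insertions are bounded by `Gi·rHist` each and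
`2Gi ≤ (2Gi/θ^{k₀})·θ^k`; altogether `StepModel.InsertionRate κ E₀ (Gi·δI/(1 − ρ₀) + 2Gi/θ^{k₀}) θ`. [folklore] -/
theorem insertionRate_of_insOp {W : Set (ℕ → ℝ)} {κ E₀ Gi δI θ ρ₀ : ℝ} {k₀ : ℕ} (hread : N.ReadsIns W)
    (henv : N.InsOpEnvelope W κ E₀ Gi) (hbdA : N.InsBoundA W κ E₀ Gi) (hrate : N.InsOpRate W δI θ) (hδI : 0 ≤ δI)
    (hθ0 : 0 < θ) (hθ1 : θ ≤ 1) (hρ₀ : ρ₀ < 1) (hreach : δI * θ ^ k₀ ≤ ρ₀) :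
    M.InsertionRate W κ E₀ (Gi * δI / (1 - ρ₀) + 2 * Gi / θ ^ k₀) θ := by
  intro k g hg U t ht
  obtain ⟨hA, hB⟩ := hread k g hg U t
  have hrI := N.rI_pos k
  have hrH := M.rHist_pos k
  have hBbd : ‖N.Ins k (N.opIB g U k) t‖ ≤ Gi * M.rHist k := N.norm_insB_le_of_envelope henv hg U ht
  have hGi : 0 ≤ Gi := (mul_nonneg_iff_of_pos_right hrH).mp ((norm_nonneg _).trans hBbd)
  have h1ρ₀ : 0 < 1 - ρ₀ := by linarith
  have hθk : 0 < θ ^ k := pow_pos hθ0 k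
  have hθk₀ : 0 < θ ^ k₀ := pow_pos hθ0 k₀
  have hT1 : 0 ≤ Gi * δI / (1 - ρ₀) := div_nonneg (mul_nonneg hGi hδI) h1ρ₀.le
  have hT2 : 0 ≤ 2 * Gi / θ ^ k₀ := div_nonneg (by positivity) hθk₀.le
  rw [hA, hB]
  rcases le_or_gt k₀ k with hk | hk
  · -- near regime: `θ^k ≤ θ^{k₀}`, the displacement is within reach
    have hpow : θ ^ k ≤ θ ^ k₀ := pow_le_pow_of_le_one hθ0.le hθ1 hk
    have hdisp : ‖N.opIA g U k - N.opIB g U k‖ ≤ ρ₀ * N.rI k :=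
      (hrate k g hg U).trans (mul_le_mul_of_nonneg_right
        ((mul_le_mul_of_nonneg_left hpow hδI).trans hreach) hrI.le)
    have hrel : ‖N.opIA g U k - N.opIB g U k‖ / N.rI k ≤ δI * θ ^ k := by
      rw [div_le_iff₀ hrI]; exact hrate k g hg U
    calc ‖N.Ins k (N.opIA g U k) t - N.Ins k (N.opIB g U k) t‖
        ≤ Gi / (1 - ρ₀) * (‖N.opIA g U k - N.opIB g U k‖ / N.rI k) * M.rHist k :=
          N.norm_ins_sub_le_of_reach henv hρ₀ hg U ht hdisp
      _ ≤ Gi / (1 - ρ₀) * (δI * θ ^ k) * M.rHist k :=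
          mul_le_mul_of_nonneg_right (mul_le_mul_of_nonneg_left hrel (div_nonneg hGi h1ρ₀.le)) hrH.le
      _ = Gi * δI / (1 - ρ₀) * θ ^ k * M.rHist k := by ring
      _ ≤ (Gi * δI / (1 - ρ₀) + 2 * Gi / θ ^ k₀) * θ ^ k * M.rHist k := by
          have : 0 ≤ 2 * Gi / θ ^ k₀ * θ ^ k * M.rHist k := by positivity
          nlinarith
  · -- first scales: triangle bound by the two one-run levels, `θ^{k₀} ≤ θ^k`
    have hpow : θ ^ k₀ ≤ θ ^ k := pow_le_pow_of_le_one hθ0.le hθ1 hk.le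
    have hAbd : ‖N.Ins k (N.opIA g U k) t‖ ≤ Gi * M.rHist k := hbdA k g hg U t ht
    calc ‖N.Ins k (N.opIA g U k) t - N.Ins k (N.opIB g U k) t‖
        ≤ ‖N.Ins k (N.opIA g U k) t‖ + ‖N.Ins k (N.opIB g U k) t‖ := norm_sub_le _ _
      _ ≤ Gi * M.rHist k + Gi * M.rHist k := add_le_add hAbd hBbd
      _ = 2 * Gi / θ ^ k₀ * θ ^ k₀ * M.rHist k := by field_simp; ring
      _ ≤ 2 * Gi / θ ^ k₀ * θ ^ k * M.rHist k :=
          mul_le_mul_of_nonneg_right (mul_le_mul_of_nonneg_left hpow hT2) hrH.le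
      _ ≤ (Gi * δI / (1 - ρ₀) + 2 * Gi / θ ^ k₀) * θ ^ k * M.rHist k := by
          have : 0 ≤ Gi * δI / (1 - ρ₀) * θ ^ k * M.rHist k := by positivity
          nlinarith

end InsOpModel

end Cauchy

/-! ## §3 The same-data reading: the insertion operators ARE the step's operator data — W4 from W1 itself -/

section SameData

variable {C : Carriers} {Op Hist : Type*} [NormedAddCommGroup Op] [NormedSpace ℂ Op] [NormedAddCommGroup Hist]
  [NormedSpace ℂ Hist]

/-- The SAME-DATA insertion-operator species: the insertion functional `Ins k : Op → table → Hist` read at the step model's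
own operator data `opA`/`opB`, margin `rOp` ([II]: V′_k of Lemma 1 p. 9 is built from the operators of (1.3)–(1.6) pp. 2–3
that the step reads). [folklore] -/
def InsOpModel.ofStep (M : StepModel C Op Hist) (Ins : ℕ → Op → (C.Dom → ℝ) → Hist) : InsOpModel M Op where
  Ins := Ins
  opIA := M.opA
  opIB := M.opB
  rI := M.rOp
  rI_pos := M.rOp_pos

variable (M : StepModel C Op Hist) (Ins : ℕ → Op → (C.Dom → ℝ) → Hist)

/-- Under the same-data reading W1-ins IS W1 (`StepModel.OperatorRate`), by `Iff.rfl`. [folklore] -/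
theorem insOpRate_ofStep_iff {W : Set (ℕ → ℝ)} {δ θ : ℝ} :
    (InsOpModel.ofStep M Ins).InsOpRate W δ θ ↔ M.OperatorRate W δ θ := Iff.rfl

variable [CompleteSpace Hist]

/-- **W4 FROM W1** (same data, reach at every scale): `OperatorRate δ θ` ∧ `ReadsIns` ∧ `InsOpEnvelope κ E₀ Gi` ∧
`δθ^k ≤ ρ₀ < 1` (all `k`) ⟹ `InsertionRate κ E₀ (Gi·δ/(1 − ρ₀)) θ`. [folklore] -/
theorem insertionRate_of_operatorRate_near {W : Set (ℕ → ℝ)} {κ E₀ Gi δ θ ρ₀ : ℝ}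
    (hread : (InsOpModel.ofStep M Ins).ReadsIns W) (henv : (InsOpModel.ofStep M Ins).InsOpEnvelope W κ E₀ Gi)
    (hop : M.OperatorRate W δ θ) (hρ₀ : ρ₀ < 1) (hreach : ∀ k, δ * θ ^ k ≤ ρ₀) :
    M.InsertionRate W κ E₀ (Gi * δ / (1 - ρ₀)) θ :=
  (InsOpModel.ofStep M Ins).insertionRate_of_insOp_near hread henv ((insOpRate_ofStep_iff M Ins).2 hop) hρ₀ hreach

/-- **W4 FROM W1** (same data, reach from `k₀` on): `OperatorRate δ θ` ∧ `ReadsIns` ∧ `InsOpEnvelope κ E₀ Gi` ∧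
`InsBoundA κ E₀ Gi` ∧ `0 < θ ≤ 1` ∧ `δθ^{k₀} ≤ ρ₀ < 1` ⟹ `InsertionRate κ E₀ (Gi·δ/(1 − ρ₀) + 2Gi/θ^{k₀}) θ`. [folklore] -/
theorem insertionRate_of_operatorRate {W : Set (ℕ → ℝ)} {κ E₀ Gi δ θ ρ₀ : ℝ} {k₀ : ℕ}
    (hread : (InsOpModel.ofStep M Ins).ReadsIns W) (henv : (InsOpModel.ofStep M Ins).InsOpEnvelope W κ E₀ Gi)
    (hbdA : (InsOpModel.ofStep M Ins).InsBoundA W κ E₀ Gi) (hop : M.OperatorRate W δ θ) (hδ : 0 ≤ δ) (hθ0 : 0 < θ)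
    (hθ1 : θ ≤ 1) (hρ₀ : ρ₀ < 1) (hreach : δ * θ ^ k₀ ≤ ρ₀) :
    M.InsertionRate W κ E₀ (Gi * δ / (1 - ρ₀) + 2 * Gi / θ ^ k₀) θ :=
  (InsOpModel.ofStep M Ins).insertionRate_of_insOp hread henv hbdA ((insOpRate_ofStep_iff M Ins).2 hop) hδ hθ0 hθ1 hρ₀
    hreach

end SameData

/-! ## §4 The row-NE5 residual with W4 PRODUCED -/

section Residual

variable {C : Carriers} {S Hist : Type*} [Fintype S] [NormedAddCommGroup Hist] [NormedSpace ℂ Hist] [CompleteSpace Hist]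
  (M : StepModel C (S → ℂ) Hist)

/-- **ROW NE5 RESIDUAL, W4 PRODUCED FROM A GENERIC INSERTION-OPERATOR SPECIES.**  `OutputRateResidual.ne5_at_of_entrywise_lip_nat`
(slower-rate face; MI-R `hrA`/`hrB`/`hbase`, W2 `hlip`, levels `hdA`/`hdB`, W1 entrywise `hent`/`hunit`/`hfl`, W3 consumed `hdamp`,
R `hnear`/`hfirst`, S `hsmall`) with the W4 binder REPLACED by `ReadsIns` ∧ `InsOpEnvelope κ E₀ Gi` ∧ `InsBoundA κ E₀ Gi` ∧
`InsOpRate δI θ` ∧ the insertion reach `δI·θ^{k₁} ≤ ρ₁ < 1`; the produced `δ′ = Gi·δI/(1 − ρ₁) + 2Gi/θ^{k₁}` is displayed in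
`hnear` and in the constant. [folklore] -/
theorem ne5_at_of_entrywise_lip_insOp_nat {OpI : Type*} [NormedAddCommGroup OpI] [NormedSpace ℂ OpI]
    (N : InsOpModel M OpI) {EA : Functional C C.BgA} {EB : Functional C C.BgB} {W : Set (ℕ → ℝ)}
    {κ Λ EA₀ E₀ c₁ r₀ Gi δI θ θ' c ω ρ₀ ρ₁ B : ℝ} {rf : ℕ → S → ℝ} {k₀ k₁ : ℕ} (hrA : M.RepresentsA EA W)
    (hrB : M.RepresentsB EB W) (hbase : M.InBase EB W) (hlip : M.DataLipschitz W κ Λ ρ₀) (hdA : DecayBound EA W EA₀ κ)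
    (hdB : DecayBound EB W E₀ κ) (hent : EntrywiseRate M W c₁ rf) (hunit : ∀ k s, rf k s ≤ θ ^ k)
    (hfl : ∀ k, r₀ ≤ M.rOp k) (hr₀ : 0 < r₀) (hc₁ : 0 ≤ c₁) (hread : N.ReadsIns W) (hienv : N.InsOpEnvelope W κ E₀ Gi)
    (hbdA : N.InsBoundA W κ E₀ Gi) (hirate : N.InsOpRate W δI θ) (hδI : 0 ≤ δI) (hGi : 0 ≤ Gi) (hρ₁ : ρ₁ < 1)
    (hreach : δI * θ ^ k₁ ≤ ρ₁) (hdamp : M.InsertionDampedNat W κ c ω) (hΛ : 0 ≤ Λ) (hθ0 : 0 < θ) (hθθ' : θ ≤ θ')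
    (hθ'1 : θ' ≤ 1) (hc : 0 ≤ c) (hω : 0 < ω)
    (hnear : (c₁ / r₀ + (Gi * δI / (1 - ρ₁) + 2 * Gi / θ ^ k₁)) * θ ^ k₀ + c * (EA₀ + E₀) / (1 - ω) ≤ ρ₀) (hB : 0 ≤ B)
    (hfirst : ∀ k < k₀, EA₀ + E₀ ≤ B * θ ^ k) (hsmall : ω + Λ * c < θ') :
    NE5 EA EB W κ θ'
      ((Λ * (c₁ / r₀ + (Gi * δI / (1 - ρ₁) + 2 * Gi / θ ^ k₁)) + B) * (θ' - ω) / (θ' - (ω + Λ * c))) :=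
  have h1ρ₁ : 0 < 1 - ρ₁ := by linarith
  ne5_at_of_entrywise_lip_nat M hrA hrB hbase hlip hdA hdB hent hunit hfl hr₀ hc₁
    (N.insertionRate_of_insOp hread hienv hbdA hirate hδI hθ0 (hθθ'.trans hθ'1) hρ₁ hreach) hdamp hΛ
    (add_nonneg (div_nonneg (mul_nonneg hGi hδI) h1ρ₁.le) (div_nonneg (by positivity) (pow_pos hθ0 k₁).le)) hθ0.le hθθ'
    hθ'1 hc hω hnear hB hfirst hsmall

/-- **ROW NE5 RESIDUAL, SAME-DATA READING — W4 WITHOUT A RATE BINDER OF ITS OWN.**  As above with the insertion operators = the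
step's operator data (`InsOpModel.ofStep M Ins`): W4 is replaced by `ReadsIns` ∧ `InsOpEnvelope κ E₀ Gi` ∧ `InsBoundA κ E₀ Gi` ∧
the reach `(c₁/r₀)·θ^{k₁} ≤ ρ₁ < 1` and NOTHING ELSE — the operator rate feeding it is W1's own entrywise binder
(`hent ∧ hunit ∧ hfl`, `δ = c₁/r₀`); `δ′ = Gi(c₁/r₀)/(1 − ρ₁) + 2Gi/θ^{k₁}`.  Route P1's residual then reads
NE5 ⇐ W1 ∧ W2 ∧ W2-ins ∧ W3 ∧ MI-R ∧ ReadsIns ∧ S ∧ R (+ insertion reach). [folklore] -/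
theorem ne5_at_of_entrywise_lip_readsIns_nat (Ins : ℕ → (S → ℂ) → (C.Dom → ℝ) → Hist) {EA : Functional C C.BgA}
    {EB : Functional C C.BgB} {W : Set (ℕ → ℝ)} {κ Λ EA₀ E₀ c₁ r₀ Gi θ θ' c ω ρ₀ ρ₁ B : ℝ} {rf : ℕ → S → ℝ}
    {k₀ k₁ : ℕ} (hrA : M.RepresentsA EA W) (hrB : M.RepresentsB EB W) (hbase : M.InBase EB W)
    (hlip : M.DataLipschitz W κ Λ ρ₀) (hdA : DecayBound EA W EA₀ κ) (hdB : DecayBound EB W E₀ κ)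
    (hent : EntrywiseRate M W c₁ rf) (hunit : ∀ k s, rf k s ≤ θ ^ k) (hfl : ∀ k, r₀ ≤ M.rOp k) (hr₀ : 0 < r₀)
    (hc₁ : 0 ≤ c₁) (hread : (InsOpModel.ofStep M Ins).ReadsIns W)
    (hienv : (InsOpModel.ofStep M Ins).InsOpEnvelope W κ E₀ Gi) (hbdA : (InsOpModel.ofStep M Ins).InsBoundA W κ E₀ Gi)
    (hGi : 0 ≤ Gi) (hρ₁ : ρ₁ < 1) (hreach : c₁ / r₀ * θ ^ k₁ ≤ ρ₁) (hdamp : M.InsertionDampedNat W κ c ω) (hΛ : 0 ≤ Λ)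
    (hθ0 : 0 < θ) (hθθ' : θ ≤ θ') (hθ'1 : θ' ≤ 1) (hc : 0 ≤ c) (hω : 0 < ω)
    (hnear : (c₁ / r₀ + (Gi * (c₁ / r₀) / (1 - ρ₁) + 2 * Gi / θ ^ k₁)) * θ ^ k₀ + c * (EA₀ + E₀) / (1 - ω) ≤ ρ₀)
    (hB : 0 ≤ B) (hfirst : ∀ k < k₀, EA₀ + E₀ ≤ B * θ ^ k) (hsmall : ω + Λ * c < θ') :
    NE5 EA EB W κ θ'
      ((Λ * (c₁ / r₀ + (Gi * (c₁ / r₀) / (1 - ρ₁) + 2 * Gi / θ ^ k₁)) + B) * (θ' - ω) / (θ' - (ω + Λ * c))) :=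
  ne5_at_of_entrywise_lip_insOp_nat M (InsOpModel.ofStep M Ins) hrA hrB hbase hlip hdA hdB hent hunit hfl hr₀ hc₁ hread
    hienv hbdA ((insOpRate_ofStep_iff M Ins).2 (operatorRate_of_entrywise_floor M hent hunit hfl hr₀ hc₁ hθ0.le))
    (div_nonneg hc₁ hr₀.le) hGi hρ₁ hreach hdamp hΛ hθ0 hθθ' hθ'1 hc hω hnear hB hfirst hsmall

end Residual

end Summit.QuantumFields.BalabanUV.T4Continuum.OutputRateInsertion

end
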